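import Summits.Ventures.HSemireg.WedgeHankelRecurrenceHankelInversePair
import Summits.Ventures.HSemireg.WedgeHankelRecurrenceJacobi

/-!
# Venture HSemireg — THE HANKEL CENSUS OF AN AERATED SEQUENCE SPLITS BY PARITY: for `â = (a₀, 0, a₁, 0, a₂, 0, …)` (`â_{2k} = a_k`, `â_{2k+1} = 0` — the moment sequence of a functional
# symmetric about `0`), re-indexing evens-first gives **`H_t(â) ≅ H_{m₁}(a) ⊕ H_{m₂}(n ↦ a_{n+1})`** (`t = m₁ + m₂ + 1`, `m₂ ≤ m₁ ≤ m₂ + 1`), hence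
# **`det H_t(â) = det H_{m₁}(a) · det H_{m₂}(a∘(·+1))`, `rank = rank + rank`, `sigPos ∕ sigNeg = sum`, `Sign = Sign + Sign`** — with the general lemma `sigPos ∕ sigNeg (A ⊕ D) = sigPos ∕ sigNeg A + sigPos ∕ sigNeg D`

HONEST FRAMING. Part of the Lean index of the computation cell `pub-hsemireg` (seat p10 gen 37, Sunday typer «UNIFORM-IN-n»).
LINEAR ALGEBRA OF HANKEL MATRICES OVER A (LINEARLY ORDERED) FIELD ONLY (`Matrix.det ∕ rank`, Mathlib's `sigPos ∕ sigNeg` through the lineage's N126 `sigPos ∕ sigNeg_comp_eq_of_surjective` and N138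
`sigPos_sigNeg_toQuadraticForm'_submatrix_equiv`; PROVED Literature `rank_fromBlocks_zero₁₂_zero₂₁`, `sigPos_prod ∕ sigNeg_prod` IMPORTED through N168): no variety, no cohomology theory, no sheaf, no Ext
group and no semiregularity map is constructed here; nothing here says that HC / HC_CM / HC_AV holds; no Literature fact (unproved `Prop`) is declared or used.  Custodian versions as in
`WedgeHankelSiegelIdeal` (1/3).
SOURCE OF THE STATEMENT: folklore of Hankel determinant evaluations and of orthogonal polynomials for symmetric weights (the moments of a symmetric functional are aerated: Belabas–Cohen, *Numerical
Algorithms for Number Theory* (AMS 2021) §3.5.2, `m*_{2n} = m_n`, `m*_{2n+1} = 0` — the tree's `Literature.NumberTheory.BelabasCohen2021.SymmetrizedScalarProduct.symMoments`, which is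
`fun n => if Even n then m (n / 2) else 0` VERBATIM the sequence used below; that module imports all of Mathlib and is therefore only NAMED here, not imported); the splitting itself is the
observation `â_{i+j} ≠ 0 ⇒ i ≡ j (mod 2)`.  I know no printed locus to cite for the rank ∕ signature forms and claim none.
presearch: «Hankel determinant aerated sequence factors ∕ symmetric moments» → corpus (hybrid) no statement-level hit (Bleher–Its 2001 pp. 27–33 orthogonal-polynomial background only); [tree]
`symMoments` (above), `CatalanLikeBinomialTransform` (aerated Catalan SERIES, no Hankel splitting); galaxy not queried beyond the N177 ∕ N178 needles (quota kept).
DEDUP DISCLOSURE (`rg` of the whole tree + Mathlib, 2026-09-02): block sums in the lineage are N164 ∕ N168 (`fromRowsᵀ (A ⊕ B) fromRows` for Euclidean steps), N174 ∕ N138 (Schur complements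
`fromBlocks A B Bᵀ D`); no file splits a Hankel matrix by parity, and no tree lemma states `sigPos (fromBlocks A 0 0 D) = sigPos A + sigPos D` (nearest: Literature `sigPos_prod` for `Q₁.prod Q₂`,
used here).  12 names: 0 hits tree-wide.

WHAT IS IN THE TREE.  N48 `CensusDet`: `hankelSq`; N126 `Inertia`: `sigPos ∕ sigNeg_comp_eq_of_surjective`; N138 `Jacobi`: **`sigPos_sigNeg_toQuadraticForm'_submatrix_equiv`** (re-indexing keeps
inertia); Literature: `Literature.LinearAlgebra.Matrix.rank_fromBlocks_zero₁₂_zero₂₁`, `Literature.LinearAlgebra.QuadraticForm.sigPos_prod ∕ sigNeg_prod`, `…DeterminantCharTwo.toQuadraticForm'_apply`;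
Mathlib: `Matrix.det_fromBlocks_zero₂₁`, `Matrix.det_submatrix_equiv_self`, `Matrix.rank_reindex`, `Matrix.fromBlocks_mulVec`, `sumElim_dotProduct_sumElim`, `Fintype.bijective_iff_injective_and_card`.
THIS FILE (namespace `Summit.Ventures.HSemireg.Wedge.HankelOuter` continued; PLAIN over N168 `HankelInversePair` + N138 `Jacobi`; 0 definitions; the aerated sequence is written inline
`fun n => if Even n then a (n / 2) else 0`):
* §831 `exists_parity_equiv` (`Fin (m₁+1) ⊕ Fin (m₂+1) ≃ Fin (t+1)`, `inl k ↦ 2k`, `inr k ↦ 2k+1`).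
* §832 **`hankelSq_aerate_submatrix_eq_fromBlocks`** (`H_t(â)∘E = H_{m₁}(a) ⊕ H_{m₂}(a∘(·+1))`), `hankelSq_aerate_eq_fromBlocks_submatrix`.
* §833 **`det_hankelSq_aerate`** (+ the two shapes `det_hankelSq_aerate_odd ∕ _even`), **`rank_hankelSq_aerate`**, `toQuadraticForm'_fromBlocks_zero_zero`, `prod_funLeft_inl_inr_surjective`,
  **`sigPos_sigNeg_fromBlocks_zero_zero`** (general block-diagonal inertia), **`sigPos_sigNeg_hankelSq_aerate`**, `sigPos_sub_sigNeg_hankelSq_aerate`.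
CAVEATS.  Sizes: `hankelSq K t` is `(t+1) × (t+1)`; the evens block has `m₁ + 1 = ⌈(t+1)/2⌉` rows and the odds block `m₂ + 1 = ⌊(t+1)/2⌋`, packaged as `t = m₁ + m₂ + 1`, `m₂ ≤ m₁ ≤ m₂ + 1`
(so `t ≥ 1`; `H_0(â) = (a₀)` needs no lemma).  Nothing Ext-side.  New names only.
-/

open Matrix

namespace Summit.Ventures.HSemireg.Wedge.HankelOuter

open Summit.Ventures.HSemireg.Wedge Summit.Ventures.HSemireg.Wedge.Hankel

section Aeration

variable {K : Type*} [Field K]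

/-! ## §831. The parity re-indexing `Fin (m₁+1) ⊕ Fin (m₂+1) ≃ Fin (t+1)`, evens first (`t = m₁ + m₂ + 1`, `m₂ ≤ m₁ ≤ m₂ + 1`) -/

/-- **The parity enumeration**: for `t = m₁ + m₂ + 1` with `m₂ ≤ m₁ ≤ m₂ + 1` there is an equivalence `E : Fin (m₁+1) ⊕ Fin (m₂+1) ≃ Fin (t+1)` with `E (inl k) = 2k` and `E (inr k) = 2k + 1`.
[bookkeeping] -/
theorem exists_parity_equiv {t m₁ m₂ : ℕ} (ht : t = m₁ + m₂ + 1) (h₁ : m₂ ≤ m₁) (h₂ : m₁ ≤ m₂ + 1) :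
    ∃ E : Fin (m₁ + 1) ⊕ Fin (m₂ + 1) ≃ Fin (t + 1), (∀ k, ((E (Sum.inl k) : Fin (t + 1)) : ℕ) = 2 * k) ∧ ∀ k, ((E (Sum.inr k) : Fin (t + 1)) : ℕ) = 2 * k + 1 := by
  let f : Fin (m₁ + 1) ⊕ Fin (m₂ + 1) → Fin (t + 1) := fun s => match s with
    | Sum.inl k => ⟨2 * k, by omega⟩
    | Sum.inr k => ⟨2 * k + 1, by omega⟩
  have hinj : Function.Injective f := by
    rintro (k | k) (l | l) h <;> have h' := congrArg Fin.val h <;> simp only [f] at h'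
    · exact congrArg Sum.inl (Fin.ext (by omega))
    · omega
    · omega
    · exact congrArg Sum.inr (Fin.ext (by omega))
  have hbij : Function.Bijective f := (Fintype.bijective_iff_injective_and_card f).2 ⟨hinj, by simp only [Fintype.card_sum, Fintype.card_fin]; omega⟩
  exact ⟨Equiv.ofBijective f hbij, fun k => rfl, fun k => rfl⟩

/-! ## §832. The Hankel sections of an AERATED sequence `â = (a₀, 0, a₁, 0, a₂, …)` split by parity into `H_{m₁}(a) ⊕ H_{m₂}(a ∘ (·+1))` -/

/-- **PARITY SPLITTING: re-indexed evens-first, `H_t(â) = H_{m₁}(a) ⊕ H_{m₂}(n ↦ a (n+1))`** for the aerated sequence `â_n = if n even then a_{n/2} else 0` (`t = m₁ + m₂ + 1`; entries `â_{2i+2j} = a_{i+j}`,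
`â_{2i+2j+1} = 0`, `â_{(2i+1)+(2j+1)} = a_{i+j+1}`). [this file, §832] -/
theorem hankelSq_aerate_submatrix_eq_fromBlocks {t m₁ m₂ : ℕ} (a : ℕ → K) (E : Fin (m₁ + 1) ⊕ Fin (m₂ + 1) ≃ Fin (t + 1))
    (hE1 : ∀ k, ((E (Sum.inl k) : Fin (t + 1)) : ℕ) = 2 * k) (hE2 : ∀ k, ((E (Sum.inr k) : Fin (t + 1)) : ℕ) = 2 * k + 1) :
    (hankelSq K t (fun n => if Even n then a (n / 2) else 0)).submatrix E E = Matrix.fromBlocks (hankelSq K m₁ a) 0 0 (hankelSq K m₂ fun n => a (n + 1)) := by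
  ext (i | i) (j | j)
  · rw [Matrix.submatrix_apply, Matrix.fromBlocks_apply₁₁, hankelSq, hankelSq, Matrix.of_apply, Matrix.of_apply, hE1, hE1, if_pos ⟨(i : ℕ) + j, by ring⟩]
    congr 1; omega
  · rw [Matrix.submatrix_apply, Matrix.fromBlocks_apply₁₂, hankelSq, Matrix.of_apply, hE1, hE2, Matrix.zero_apply, if_neg (by rw [Nat.even_iff]; omega)]
  · rw [Matrix.submatrix_apply, Matrix.fromBlocks_apply₂₁, hankelSq, Matrix.of_apply, hE2, hE1, Matrix.zero_apply, if_neg (by rw [Nat.even_iff]; omega)]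
  · rw [Matrix.submatrix_apply, Matrix.fromBlocks_apply₂₂, hankelSq, hankelSq, Matrix.of_apply, Matrix.of_apply, hE2, hE2, if_pos ⟨(i : ℕ) + j + 1, by ring⟩]
    congr 1; omega

/-- The same as an identity of `(t+1) × (t+1)` matrices: `H_t(â) = (H_{m₁}(a) ⊕ H_{m₂}(a∘(·+1))) ∘ E⁻¹`. [this file, §832] -/
theorem hankelSq_aerate_eq_fromBlocks_submatrix {t m₁ m₂ : ℕ} (a : ℕ → K) (E : Fin (m₁ + 1) ⊕ Fin (m₂ + 1) ≃ Fin (t + 1))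
    (hE1 : ∀ k, ((E (Sum.inl k) : Fin (t + 1)) : ℕ) = 2 * k) (hE2 : ∀ k, ((E (Sum.inr k) : Fin (t + 1)) : ℕ) = 2 * k + 1) :
    hankelSq K t (fun n => if Even n then a (n / 2) else 0) = (Matrix.fromBlocks (hankelSq K m₁ a) 0 0 (hankelSq K m₂ fun n => a (n + 1))).submatrix E.symm E.symm := by
  rw [← hankelSq_aerate_submatrix_eq_fromBlocks a E hE1 hE2, Matrix.submatrix_submatrix, Equiv.self_comp_symm, Matrix.submatrix_id_id]

/-! ## §833. Consequences: determinant = product, rank = sum, signature = sum («the Hankel determinants of an aerated sequence ∕ of a symmetric moment sequence factor») -/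

/-- **`det H_t(â) = det H_{m₁}(a) · det H_{m₂}(a∘(·+1))`** for `t = m₁ + m₂ + 1`, `m₂ ≤ m₁ ≤ m₂ + 1` (i.e. `m₁ = ⌈t/2⌉`, `m₂ = ⌊t/2⌋` … precisely `m₁ + 1 = ⌈(t+1)/2⌉` evens, `m₂ + 1 = ⌊(t+1)/2⌋` odds).
[this file, §833] -/
theorem det_hankelSq_aerate {t m₁ m₂ : ℕ} (ht : t = m₁ + m₂ + 1) (h₁ : m₂ ≤ m₁) (h₂ : m₁ ≤ m₂ + 1) (a : ℕ → K) :
    (hankelSq K t (fun n => if Even n then a (n / 2) else 0)).det = (hankelSq K m₁ a).det * (hankelSq K m₂ fun n => a (n + 1)).det := by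
  obtain ⟨E, hE1, hE2⟩ := exists_parity_equiv ht h₁ h₂
  rw [hankelSq_aerate_eq_fromBlocks_submatrix a E hE1 hE2, Matrix.det_submatrix_equiv_self, Matrix.det_fromBlocks_zero₂₁]

/-- The two shapes spelled out: EVEN number of rows `t + 1 = 2m + 2` — `det H_{2m+1}(â) = det H_m(a) · det H_m(a∘(·+1))`. [this file, §833] -/
theorem det_hankelSq_aerate_odd (m : ℕ) (a : ℕ → K) :
    (hankelSq K (2 * m + 1) (fun n => if Even n then a (n / 2) else 0)).det = (hankelSq K m a).det * (hankelSq K m fun n => a (n + 1)).det :=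
  det_hankelSq_aerate (by omega) le_rfl (Nat.le_succ m) a

/-- ODD number of rows `t + 1 = 2m + 3` — `det H_{2m+2}(â) = det H_{m+1}(a) · det H_m(a∘(·+1))`. [this file, §833] -/
theorem det_hankelSq_aerate_even (m : ℕ) (a : ℕ → K) :
    (hankelSq K (2 * m + 2) (fun n => if Even n then a (n / 2) else 0)).det = (hankelSq K (m + 1) a).det * (hankelSq K m fun n => a (n + 1)).det :=
  det_hankelSq_aerate (by omega) (Nat.le_succ m) le_rfl a

/-- **`rank H_t(â) = rank H_{m₁}(a) + rank H_{m₂}(a∘(·+1))`.** [this file, §833] -/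
theorem rank_hankelSq_aerate {t m₁ m₂ : ℕ} (ht : t = m₁ + m₂ + 1) (h₁ : m₂ ≤ m₁) (h₂ : m₁ ≤ m₂ + 1) (a : ℕ → K) :
    (hankelSq K t (fun n => if Even n then a (n / 2) else 0)).rank = (hankelSq K m₁ a).rank + (hankelSq K m₂ fun n => a (n + 1)).rank := by
  obtain ⟨E, hE1, hE2⟩ := exists_parity_equiv ht h₁ h₂
  rw [hankelSq_aerate_eq_fromBlocks_submatrix a E hE1 hE2, ← Matrix.reindex_apply, Matrix.rank_reindex, Literature.LinearAlgebra.Matrix.rank_fromBlocks_zero₁₂_zero₂₁]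

/-- The quadratic form of a block-diagonal matrix is the orthogonal sum pulled back along the coordinate splitting `v ↦ (v ∘ inl, v ∘ inr)`. [bookkeeping] -/
theorem toQuadraticForm'_fromBlocks_zero_zero {m n : Type*} [Fintype m] [Fintype n] [DecidableEq m] [DecidableEq n] (A : Matrix m m K) (D : Matrix n n K) :
    (Matrix.fromBlocks A 0 0 D).toQuadraticForm'
      = (A.toQuadraticForm'.prod D.toQuadraticForm').comp ((LinearMap.funLeft K K Sum.inl).prod (LinearMap.funLeft K K Sum.inr)) := by
  ext v
  rw [QuadraticMap.comp_apply, QuadraticMap.prod_apply]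
  change _ = A.toQuadraticForm' (v ∘ Sum.inl) + D.toQuadraticForm' (v ∘ Sum.inr)
  rw [Literature.LinearAlgebra.QuadraticForm.DeterminantCharTwo.toQuadraticForm'_apply, Literature.LinearAlgebra.QuadraticForm.DeterminantCharTwo.toQuadraticForm'_apply,
    Literature.LinearAlgebra.QuadraticForm.DeterminantCharTwo.toQuadraticForm'_apply, Matrix.fromBlocks_mulVec, Matrix.zero_mulVec, Matrix.zero_mulVec, add_zero, zero_add]
  conv_lhs => rw [← Sum.elim_comp_inl_inr v]
  rw [sumElim_dotProduct_sumElim]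
  rfl

/-- The coordinate splitting is onto. [bookkeeping] -/
theorem prod_funLeft_inl_inr_surjective {m n : Type*} : Function.Surjective ((LinearMap.funLeft K K (Sum.inl : m → m ⊕ n)).prod (LinearMap.funLeft K K (Sum.inr : n → m ⊕ n))) := by
  rintro ⟨x, y⟩
  exact ⟨Sum.elim x y, rfl⟩

variable [LinearOrder K] [IsStrictOrderedRing K]

/-- **Inertia of a block-diagonal symmetric matrix: `sigPos (A ⊕ D) = sigPos A + sigPos D`, `sigNeg (A ⊕ D) = sigNeg A + sigNeg D`** (Literature `sigPos_prod ∕ sigNeg_prod` pulled back along the onto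
splitting, N126). [this file, §833] -/
theorem sigPos_sigNeg_fromBlocks_zero_zero {m n : Type*} [Fintype m] [Fintype n] [DecidableEq m] [DecidableEq n] (A : Matrix m m K) (D : Matrix n n K) :
    sigPos (Matrix.fromBlocks A 0 0 D).toQuadraticForm' = sigPos A.toQuadraticForm' + sigPos D.toQuadraticForm'
      ∧ sigNeg (Matrix.fromBlocks A 0 0 D).toQuadraticForm' = sigNeg A.toQuadraticForm' + sigNeg D.toQuadraticForm' := by
  rw [toQuadraticForm'_fromBlocks_zero_zero, sigPos_comp_eq_of_surjective _ prod_funLeft_inl_inr_surjective, sigNeg_comp_eq_of_surjective _ prod_funLeft_inl_inr_surjective,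
    Literature.LinearAlgebra.QuadraticForm.sigPos_prod, Literature.LinearAlgebra.QuadraticForm.sigNeg_prod]
  exact ⟨rfl, rfl⟩

/-- **`sigPos H_t(â) = sigPos H_{m₁}(a) + sigPos H_{m₂}(a∘(·+1))` and the same for `sigNeg`** (linearly ordered field). [this file, §833] -/
theorem sigPos_sigNeg_hankelSq_aerate {t m₁ m₂ : ℕ} (ht : t = m₁ + m₂ + 1) (h₁ : m₂ ≤ m₁) (h₂ : m₁ ≤ m₂ + 1) (a : ℕ → K) :
    sigPos (hankelSq K t (fun n => if Even n then a (n / 2) else 0)).toQuadraticForm' = sigPos (hankelSq K m₁ a).toQuadraticForm' + sigPos (hankelSq K m₂ fun n => a (n + 1)).toQuadraticForm'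
      ∧ sigNeg (hankelSq K t (fun n => if Even n then a (n / 2) else 0)).toQuadraticForm' = sigNeg (hankelSq K m₁ a).toQuadraticForm' + sigNeg (hankelSq K m₂ fun n => a (n + 1)).toQuadraticForm' := by
  obtain ⟨E, hE1, hE2⟩ := exists_parity_equiv ht h₁ h₂
  obtain ⟨hp, hn⟩ := sigPos_sigNeg_toQuadraticForm'_submatrix_equiv (Matrix.fromBlocks (hankelSq K m₁ a) 0 0 (hankelSq K m₂ fun n => a (n + 1))) E.symm
  obtain ⟨hp', hn'⟩ := sigPos_sigNeg_fromBlocks_zero_zero (hankelSq K m₁ a) (hankelSq K m₂ fun n => a (n + 1))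
  rw [hankelSq_aerate_eq_fromBlocks_submatrix a E hE1 hE2, hp, hn, hp', hn']
  exact ⟨rfl, rfl⟩

/-- **The Hankel-form SIGNATURE of an aerated sequence is the sum of the two half signatures**: `Sign H_t(â) = Sign H_{m₁}(a) + Sign H_{m₂}(a∘(·+1))` (e.g. for the moment sequence of a measure
symmetric about `0`, whose odd moments vanish). [this file, §833] -/
theorem sigPos_sub_sigNeg_hankelSq_aerate {t m₁ m₂ : ℕ} (ht : t = m₁ + m₂ + 1) (h₁ : m₂ ≤ m₁) (h₂ : m₁ ≤ m₂ + 1) (a : ℕ → K) :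
    (sigPos (hankelSq K t (fun n => if Even n then a (n / 2) else 0)).toQuadraticForm' : ℤ) - sigNeg (hankelSq K t (fun n => if Even n then a (n / 2) else 0)).toQuadraticForm'
      = ((sigPos (hankelSq K m₁ a).toQuadraticForm' : ℤ) - sigNeg (hankelSq K m₁ a).toQuadraticForm')
        + ((sigPos (hankelSq K m₂ fun n => a (n + 1)).toQuadraticForm' : ℤ) - sigNeg (hankelSq K m₂ fun n => a (n + 1)).toQuadraticForm') := by
  obtain ⟨hp, hn⟩ := sigPos_sigNeg_hankelSq_aerate ht h₁ h₂ a
  rw [hp, hn]; push_cast; ring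

end Aeration

end Summit.Ventures.HSemireg.Wedge.HankelOuter
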